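import Summits.HodgeConjecture.HodgeConjecture.Theses.RankFourFaces
import Summits.HodgeConjecture.CorCM.RankFourCMProductCMType
import HarnessLib

/-!
# Route `RankFourFaces`, crux `FaceReduction` (stmt-HodgeConjecture-16266), line `birth`:
# stub B2 `stub_latticeRankReduction` — the rank bound `B⁴ ⟹ B^∞`

HONEST FRAMING (prover, cell pub-hodgecm2 / COR-CM seat b24 gen 21; theorem only, no definition, no named fact; no case
of the Hodge conjecture is proved — an implication between two pointwise statements is).  The registered stub
`stub_latticeRankReduction : RankFourCMProductWeilClassesAlgebraic → CMProductWeilClassesAlgebraic` of the skeleton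
`Summits/HodgeConjecture/HodgeConjecture/Cruxes/FaceReduction/Lines/birth.lean` (sha 907f1396fc06): if the rational
`(2,2)` E-Weil classes of every E-CM 4-product of Weil type are algebraic (`g ≥ 2`), then the rational `(k,k)` E-Weil
classes of every E-CM `2k`-product of Weil type are algebraic, every `k ≥ 1`, every `g ≥ 1`.  The two statements are
restated VERBATIM as local notations (their `def`s live in the crux workfile, which a Theorems file may not import), so
the theorem below carries the registered signature token for token and elaborates to the skeleton's statement.

PROOF (not the 2001 lattice theorem the line card anticipated, but a detour through the whole CM sector, available in
the tree since cell pub-hodgecm2): `B⁴ ⟹ HC_CM` (`CorCM.RankFourWeil.hc_cm_of_rankFourCMProductWeilClassesAlgebraic`: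
the CM corner products `⨁_j A_{(F, f.corner j)}` of the rank-four faces of the Galois CM fields `F` of degree `≥ 6` ARE
E-CM 4-products of Weil type, their `W_F ⊗ ℂ` is the face Weil-line space, whose algebraicity is `W_RK4` on the model
universe, and `W_RK4 ⟹ HC_CM` by [QW8] face reduction + André/Pohlmann/Deligne–Milne exhaustion,
`CorCM.SliceExhaustion.hc_cm_of_w_rk4`) and `HC_CM ⟹ B^∞` (`CorCM.RankFourWeil.cmProductWeilClassesAlgebraic_of_hc_cm`:
an abstract E-CM product is of CM type).  In fact `B⁴ ↔ HC_CM ↔ B^∞`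
(`CorCM.RankFourWeil.hc_cm_iff_rankFourCMProductWeilClassesAlgebraic`, `hc_cm_iff_cmProductWeilClassesAlgebraic`).

References: [Andre1992HodgeCM] Y. André, Progr. Math. 102 (1992), Théorème; [Pohlmann1968] Ann. Math. 88, Thm. 1;
[MoonenZarhin1998WeilClasses] §1; [CharlesSchnell2014Notes] Lemma 11.5.18, Thm. 11.5.21, Prop. 11.5.22;
[Milne1999] §2 p. 54; rfwf v3 Thm 1.3 / [QW8] Thm 2.5 (`CorCM/Geometry/Statements.lean`).
-/

set_option linter.dupNamespace false

open CategoryTheory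

namespace Summit.HodgeConjecture.HodgeConjecture.Theorems

/-- `RankFourCMProductWeilClassesAlgebraic` — statement `B⁴` of the crux line, LOCAL NOTATION ONLY, expanding to the
VERBATIM body of the `def RankFourCMProductWeilClassesAlgebraic : Prop` of `Cruxes/FaceReduction/Lines/birth.lean`
(skeleton 907f1396fc06; that workfile is not importable from `Theorems/`, so — as in
`PadicSemiregularLiftHodgeAbelianVarietiesStubAndreCM.lean` — the registered signature is reproduced token for token by a
notation and the theorem below elaborates to the skeleton's statement definitionally): rational `(2,2)` E-Weil classes on
E-CM 4-products of Weil type are algebraic (`g ≥ 2`). [cite: MoonenZarhin1998WeilClasses, §1]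
[cite: CharlesSchnell2014Notes, Prop. 11.5.22] -/
local notation3 (prettyPrint := false) "RankFourCMProductWeilClassesAlgebraic" =>
  (∀ (g : ℕ), 2 ≤ g → ∀ (P : Polynomial ℤ), P.Monic → P.natDegree = 2 * g →
    Irreducible (P.map (Int.castRingHom ℚ)) →
    (∀ ρ : ℂ, Polynomial.eval₂ (Int.castRingHom ℂ) ρ P = 0 → ρ.im ≠ 0) →
    (∃ Q : Polynomial ℚ, ∀ ρ : ℂ, Polynomial.eval₂ (Int.castRingHom ℂ) ρ P = 0 →
    Polynomial.aeval ρ Q = (starRingEnd ℂ) ρ) →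
    ∀ (B : Fin 4 → Literature.AlgebraicGeometry.Motives.AbelianVariety ℂ) (ψ : ∀ i, B i ⟶ B i),
    (∀ i, (B i).dim = g) →
    (∀ i, Polynomial.eval₂ (Int.castRingHom (CategoryTheory.End (B i)))
    (ψ i : CategoryTheory.End (B i)) P = 0) →
    ∀ (Y : Literature.AlgebraicGeometry.Motives.AbelianVariety ℂ) (φ : Y ⟶ Y) (π : ∀ i, Y ⟶ B i),
    (∀ i, π i ≫ ψ i = φ ≫ π i) →
    Nonempty (CategoryTheory.Limits.IsLimit (CategoryTheory.Limits.Fan.mk Y π)) →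
    Y.dim = 4 * g →
    Literature.AlgebraicGeometry.Motives.IsSmoothProjective (4 * g) Y.X →
    Polynomial.eval₂ (Int.castRingHom (CategoryTheory.End Y)) (φ : CategoryTheory.End Y) P = 0 →
    (∀ c ∈ (⨆ ρ ∈ {ρ : ℂ | Polynomial.eval₂ (Int.castRingHom ℂ) ρ P = 0},
    Literature.AlgebraicGeometry.HodgeTheory.pullbackEigenclasses Y φ 4
    (fun x y => ((x : ℂ) + (y : ℂ) * ρ) ^ 4)),
    Literature.AlgebraicGeometry.HodgeTheory.IsOfHodgeType (4 * g) Y.X 4 2 2 c) →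
    ∀ c : Literature.AlgebraicGeometry.HodgeTheory.complexBetti Y.X 4,
    Literature.AlgebraicGeometry.HodgeTheory.IsRationalClass c →
    Literature.AlgebraicGeometry.HodgeTheory.IsOfHodgeType (4 * g) Y.X 4 2 2 c →
    c ∈ (⨆ ρ ∈ {ρ : ℂ | Polynomial.eval₂ (Int.castRingHom ℂ) ρ P = 0},
    Literature.AlgebraicGeometry.HodgeTheory.pullbackEigenclasses Y φ 4
    (fun x y => ((x : ℂ) + (y : ℂ) * ρ) ^ 4)) →
    c ∈ Literature.AlgebraicGeometry.HodgeTheory.algebraicClasses Y.X 2)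

/-- `CMProductWeilClassesAlgebraic` — statement `B^∞` of the crux line, LOCAL NOTATION ONLY, expanding to the VERBATIM body
of the `def CMProductWeilClassesAlgebraic : Prop` of `Cruxes/FaceReduction/Lines/birth.lean` (skeleton 907f1396fc06):
rational `(k,k)` E-Weil classes on E-CM `2k`-products of Weil type are algebraic, every `k ≥ 1`, every CM polynomial `P`
of degree `2g`, `g ≥ 1`. [cite: Andre1992HodgeCM, Théorème] [cite: CharlesSchnell2014Notes, Lemma 11.5.18] -/
local notation3 (prettyPrint := false) "CMProductWeilClassesAlgebraic" =>
  (∀ (g : ℕ), 1 ≤ g → ∀ (P : Polynomial ℤ), P.Monic → P.natDegree = 2 * g →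
    Irreducible (P.map (Int.castRingHom ℚ)) →
    (∀ ρ : ℂ, Polynomial.eval₂ (Int.castRingHom ℂ) ρ P = 0 → ρ.im ≠ 0) →
    (∃ Q : Polynomial ℚ, ∀ ρ : ℂ, Polynomial.eval₂ (Int.castRingHom ℂ) ρ P = 0 →
    Polynomial.aeval ρ Q = (starRingEnd ℂ) ρ) →
    ∀ (k : ℕ), 1 ≤ k →
    ∀ (B : Fin (2 * k) → Literature.AlgebraicGeometry.Motives.AbelianVariety ℂ) (ψ : ∀ i, B i ⟶ B i),
    (∀ i, (B i).dim = g) →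
    (∀ i, Polynomial.eval₂ (Int.castRingHom (CategoryTheory.End (B i)))
    (ψ i : CategoryTheory.End (B i)) P = 0) →
    ∀ (Y : Literature.AlgebraicGeometry.Motives.AbelianVariety ℂ) (φ : Y ⟶ Y) (π : ∀ i, Y ⟶ B i),
    (∀ i, π i ≫ ψ i = φ ≫ π i) →
    Nonempty (CategoryTheory.Limits.IsLimit (CategoryTheory.Limits.Fan.mk Y π)) →
    Y.dim = 2 * k * g →
    Literature.AlgebraicGeometry.Motives.IsSmoothProjective (2 * k * g) Y.X →
    Polynomial.eval₂ (Int.castRingHom (CategoryTheory.End Y)) (φ : CategoryTheory.End Y) P = 0 →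
    (∀ c ∈ (⨆ ρ ∈ {ρ : ℂ | Polynomial.eval₂ (Int.castRingHom ℂ) ρ P = 0},
    Literature.AlgebraicGeometry.HodgeTheory.pullbackEigenclasses Y φ (2 * k)
    (fun x y => ((x : ℂ) + (y : ℂ) * ρ) ^ (2 * k))),
    Literature.AlgebraicGeometry.HodgeTheory.IsOfHodgeType (2 * k * g) Y.X (2 * k) k k c) →
    ∀ c : Literature.AlgebraicGeometry.HodgeTheory.complexBetti Y.X (2 * k),
    Literature.AlgebraicGeometry.HodgeTheory.IsRationalClass c →
    Literature.AlgebraicGeometry.HodgeTheory.IsOfHodgeType (2 * k * g) Y.X (2 * k) k k c →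
    c ∈ (⨆ ρ ∈ {ρ : ℂ | Polynomial.eval₂ (Int.castRingHom ℂ) ρ P = 0},
    Literature.AlgebraicGeometry.HodgeTheory.pullbackEigenclasses Y φ (2 * k)
    (fun x y => ((x : ℂ) + (y : ℂ) * ρ) ^ (2 * k))) →
    c ∈ Literature.AlgebraicGeometry.HodgeTheory.algebraicClasses Y.X k)

/-- **Stub B2 of the line `birth` — the rank bound `B⁴ ⟹ B^∞`** (registered signature
`RankFourCMProductWeilClassesAlgebraic → CMProductWeilClassesAlgebraic`, token for token via the local notations above): rational `(2,2)` E-Weil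
classes algebraic on E-CM 4-products of Weil type (`g ≥ 2`) ⟹ rational `(k,k)` E-Weil classes algebraic on E-CM
`2k`-products of Weil type (all `k ≥ 1`, `g ≥ 1`).  Proof: `B⁴ ⟹ HC_CM ⟹ B^∞`
(`CorCM.RankFourWeil.hc_cm_of_rankFourCMProductWeilClassesAlgebraic`, `cmProductWeilClassesAlgebraic_of_hc_cm`).
[cite: Andre1992HodgeCM, Théorème] [cite: Pohlmann1968, Thm. 1] [cite: CharlesSchnell2014Notes, Prop. 11.5.22] -/
theorem stub_latticeRankReduction : RankFourCMProductWeilClassesAlgebraic → CMProductWeilClassesAlgebraic :=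
  fun h => Summit.HodgeConjecture.CorCM.RankFourWeil.cmProductWeilClassesAlgebraic_of_hc_cm
    (Summit.HodgeConjecture.CorCM.RankFourWeil.hc_cm_of_rankFourCMProductWeilClassesAlgebraic h)

end Summit.HodgeConjecture.HodgeConjecture.Theorems
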